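import Literature.NumberTheory.Sieve.LinearEquationsInPrimesSingularSeries
import Literature.Barriers.Parity.SmallScalePatternsAP
import HarnessLib

/-!
# Linear equations in primes: local obstructions and the sign of the singular product

Trunk T-SIEVE (`Literature/NumberTheory/Sieve`). Green–Tao 2010 remark after Lemma 1.3: the
singular product `∏_p β_p` "could vanish, thanks to the presence of the small primes". For a prime
`p`, `β_p = p^{-d} (p/(p-1))^t g_p` with `g_p = goodCount Ψ p`, the number of `n ∈ (ℤ/p)^d` at which
no form vanishes mod `p` (the tree's `localFactor_prime`); so `β_p > 0 ↔ g_p > 0` (no LOCAL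
OBSTRUCTION at `p`, `goodCount_pos_iff_localFactor_pos`), and:

* `singularProduct_pos_of_localFactor_pos` — if every `β_p > 0`, then `∏_p β_p > 0`: on a tail
  `∏ β_p ≥ 1 - ∑ |β_p - 1| ≥ ½` (Weierstrass' product inequality, the tree's
  `Literature.Barriers.Parity.APSystem.prod_ge_one_sub_sum`, and the
  tree's `summable_norm_localFactor_sub_one`, Green–Tao's `β_p = 1 + O(p⁻²)`), the head being a
  positive constant;
* `singularProduct_eq_zero_of_localFactor_eq_zero` — one vanishing `β_p` kills the product;
* one-dimensional good counts (`d = 1`, forms `a v + b`): a form with `p ∤ a` has exactly one zero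
  mod `p` (`card_zeros_eq_one_of_coeff`); deleting a form loses at most its zeros
  (`goodCount_removeNth_le_add`); `s` forms with unit leading coefficients kill at most `s` residues
  (`le_goodCount_add`); and `‖Φ‖_N ≤ L` with non-degeneracy makes every leading coefficient a unit
  modulo any prime `p > L` (`coeff_ne_zero_mod_of_affLinSize_le`).

All elementary. Recorded because the problem side (route `LeeYangFibres`: sections of the
cell-parity law, where `H = 𝔖(Ψ)/𝔖(Ψ₋ᵢ)`) needs `𝔖 > 0` off the local obstructions, which the
tree only had for progression systems (`Literature/Barriers/Parity/SmallScalePatternsAP.lean`).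

## References

* B. Green, T. Tao, *Linear equations in primes*, Ann. of Math. (2) 171 (2010), 1753–1850:
  Lemma 1.3, (1.6)–(1.7) and the sentence following Lemma 1.3. [GreenTao2010]
-/

noncomputable section

open Filter Finset
open scoped Topology

namespace Literature.NumberTheory.Sieve

variable {d t : ℕ}

/-! ### Local obstructions and the singular product -/

/-- **No local obstruction at `p`** in terms of the local factor: `g_p(Φ) > 0 ↔ β_p(Φ) > 0`
(`β_p = p^{-d}(p/(p-1))^t g_p`). [cite: GreenTao2010, (1.6) and proof of Lemma 1.3] -/
theorem goodCount_pos_iff_localFactor_pos (Φ : Fin t → AffLinForm d) {p : ℕ} (hp : p.Prime) :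
    (haveI : NeZero p := ⟨hp.ne_zero⟩; 0 < goodCount Φ p) ↔ 0 < localFactor Φ p := by
  haveI := Fact.mk hp
  have hp2 : (2 : ℝ) ≤ p := by exact_mod_cast hp.two_le
  have hr : (0 : ℝ) < (p : ℝ) / (p - 1) := div_pos (by linarith) (by linarith)
  have hpd : (0 : ℝ) < ((p : ℝ) ^ d)⁻¹ := by positivity
  rw [localFactor_prime]
  constructor
  · intro h
    have h' : (0 : ℝ) < goodCount Φ p := by exact_mod_cast h
    positivity
  · intro h
    by_contra h0
    push Not at h0
    rw [Nat.eq_zero_of_le_zero h0, Nat.cast_zero, mul_zero, mul_zero] at h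
    exact lt_irrefl _ h

/-- **A system without local obstruction has positive singular product**: if `β_p(Φ) > 0` for
every prime `p` (and `Φ` is non-degenerate, so that `∏_{p ≤ x} β_p → 𝔖(Φ)` and
`∑_p |β_p - 1| < ∞`, Green–Tao's Lemma 1.3), then `𝔖(Φ) > 0`: beyond some `P₀` the tail products
satisfy `∏_{P₀ ≤ p ≤ x} β_p ≥ 1 - ∑_{p ≥ P₀} |β_p - 1| ≥ ½`, and `∏_{p < P₀} β_p > 0`.
[cite: GreenTao2010, Lemma 1.3 and the sentence following it] -/
theorem singularProduct_pos_of_localFactor_pos (Φ : Fin t → AffLinForm d)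
    (hΦ : IsNondegenerateSystem Φ) (hpos : ∀ p : ℕ, p.Prime → 0 < localFactor Φ p) :
    0 < singularProduct Φ := by
  set F : ℕ → ℝ := fun n => if n.Prime then localFactor Φ n else 1 with hF
  have hFpos : ∀ n, 0 < F n := fun n => by
    by_cases hn : n.Prime
    · simp only [hF, hn, if_true]; exact hpos n hn
    · simp only [hF, hn, if_false]; exact one_pos
  have hsum := summable_norm_localFactor_sub_one Φ hΦ
  set T : ℝ := ∑' n, ‖F n - 1‖ with hT
  have ht : Tendsto (fun m => ∑ n ∈ Finset.range m, ‖F n - 1‖) atTop (𝓝 T) :=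
    hsum.tendsto_sum_tsum_nat
  obtain ⟨P₀, hP₀⟩ :=
    eventually_atTop.mp (ht.eventually (lt_mem_nhds (by linarith : T - 1 / 2 < T)))
  have htail : ∀ m, ∑ n ∈ Finset.Ico P₀ m, ‖F n - 1‖ ≤ 1 / 2 := by
    intro m
    rcases le_or_gt m P₀ with hm | hm
    · rw [Finset.Ico_eq_empty_of_le hm, Finset.sum_empty]; norm_num
    · rw [Finset.sum_Ico_eq_sub _ hm.le]
      have h1 := hP₀ P₀ le_rfl
      have h2 : ∑ n ∈ Finset.range m, ‖F n - 1‖ ≤ T :=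
        hsum.sum_le_tsum (Finset.range m) fun n _ => norm_nonneg _
      linarith
  set c₀ : ℝ := ∏ n ∈ Finset.range P₀, F n with hc₀
  have hc₀pos : 0 < c₀ := Finset.prod_pos fun n _ => hFpos n
  have hlow : ∀ x : ℕ, P₀ ≤ x → c₀ / 2 ≤ singularProductPartial Φ x := by
    intro x hx
    rw [singularProductPartial_eq_prod_range,
      ← Finset.prod_range_mul_prod_Ico F (by omega : P₀ ≤ x + 1)]
    have hW := Literature.Barriers.Parity.APSystem.prod_ge_one_sub_sum (Finset.Ico P₀ (x + 1)) F
      (fun n => ‖F n - 1‖)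
      (fun n _ => (hFpos n).le) (fun n _ => norm_nonneg _) fun n _ => by
        rw [Real.norm_eq_abs]
        linarith [le_abs_self (1 - F n), abs_sub_comm (F n) 1]
    have h2 : 1 / 2 ≤ ∏ n ∈ Finset.Ico P₀ (x + 1), F n := by linarith [htail (x + 1)]
    calc c₀ / 2 = c₀ * (1 / 2) := by ring
      _ ≤ c₀ * ∏ n ∈ Finset.Ico P₀ (x + 1), F n := mul_le_mul_of_nonneg_left h2 hc₀pos.le
  exact lt_of_lt_of_le (half_pos hc₀pos) (ge_of_tendsto (tendsto_singularProductPartial_holds d t Φ hΦ)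
    (eventually_atTop.2 ⟨P₀, hlow⟩))

/-- **A vanishing local factor kills the singular product**: `β_p(Φ) = 0 ⟹ 𝔖(Φ) = 0` (the partial
products vanish from `p` on). [cite: GreenTao2010, sentence following Lemma 1.3] -/
theorem singularProduct_eq_zero_of_localFactor_eq_zero (Φ : Fin t → AffLinForm d)
    (hΦ : IsNondegenerateSystem Φ) {p : ℕ} (hp : p.Prime) (hβ : localFactor Φ p = 0) :
    singularProduct Φ = 0 := by
  have hev : ∀ x : ℕ, p ≤ x → singularProductPartial Φ x = 0 := fun x hx =>
    Finset.prod_eq_zero (Nat.mem_primesLE.mpr ⟨hx, hp⟩) hβ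
  exact tendsto_nhds_unique (tendsto_singularProductPartial_holds d t Φ hΦ)
    (tendsto_const_nhds.congr' (eventually_atTop.2 ⟨p, fun x hx => (hev x hx).symm⟩))

/-! ### Good counts of one-dimensional systems -/

/-- A one-dimensional form with a unit leading coefficient mod `p` has exactly one zero in `ℤ/p`.
[folklore] -/
theorem card_zeros_eq_one_of_coeff {p : ℕ} [Fact p.Prime] (ψ : AffLinForm 1)
    (ha : ((ψ.coeff 0 : ℤ) : ZMod p) ≠ 0) :
    #{v : Fin 1 → ZMod p | ψ.modEval p v = 0} = 1 := by
  have h := card_modZero_mul ψ (fun hz => ha (by simpa using congr_fun hz 0))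
  rw [pow_one] at h
  exact Nat.eq_of_mul_eq_mul_right (Fact.out : p.Prime).pos (h.trans (one_mul p).symm)

/-- Deleting a form loses at most its zeros: `g_p(Φ₋ᵢ) ≤ g_p(Φ) + #{zeros of φ_i mod p}`.
[folklore] -/
theorem goodCount_removeNth_le_add {s : ℕ} (Φ : Fin (s + 1) → AffLinForm d) (i : Fin (s + 1))
    (p : ℕ) [NeZero p] :
    goodCount (Fin.removeNth i Φ) p ≤
      goodCount Φ p + #{v : Fin d → ZMod p | (Φ i).modEval p v = 0} := by
  unfold goodCount
  calc _ ≤ #((Finset.univ.filter fun v : Fin d → ZMod p => ∀ k, ¬ (Φ k).modEval p v = 0) ∪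
          Finset.univ.filter fun v : Fin d → ZMod p => (Φ i).modEval p v = 0) :=
        Finset.card_le_card ?_
    _ ≤ _ := Finset.card_union_le _ _
  intro v hv
  simp only [Finset.mem_filter, Finset.mem_univ, true_and, Finset.mem_union] at hv ⊢
  by_cases h : (Φ i).modEval p v = 0
  · exact Or.inr h
  · refine Or.inl fun k => ?_
    rcases Fin.eq_self_or_eq_succAbove i k with rfl | ⟨l, rfl⟩
    · exact h
    · exact hv l

/-- `s` one-dimensional forms with unit leading coefficients mod `p` kill at most `s` residues:
`p ≤ g_p(Φ) + s`. [folklore] -/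
theorem le_goodCount_add {s : ℕ} (Φ : Fin s → AffLinForm 1) (p : ℕ) [Fact p.Prime]
    (ha : ∀ k, (((Φ k).coeff 0 : ℤ) : ZMod p) ≠ 0) : p ≤ goodCount Φ p + s := by
  have hbad : #(Finset.univ.filter fun v : Fin 1 → ZMod p => ¬ ∀ k, ¬ (Φ k).modEval p v = 0) ≤ s := by
    have h1 : (Finset.univ.filter fun v : Fin 1 → ZMod p => ¬ ∀ k, ¬ (Φ k).modEval p v = 0) =
        Finset.univ.biUnion fun k => Finset.univ.filter fun v : Fin 1 → ZMod p =>
          (Φ k).modEval p v = 0 := by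
      ext v
      simp
    rw [h1]
    refine Finset.card_biUnion_le.trans ?_
    rw [Finset.sum_congr rfl fun k _ => card_zeros_eq_one_of_coeff (Φ k) (ha k)]
    simp
  have htot := Finset.card_filter_add_card_filter_not (s := (Finset.univ : Finset (Fin 1 → ZMod p)))
    (fun v => ∀ k, ¬ (Φ k).modEval p v = 0)
  rw [Finset.card_univ, card_zmod_pow, pow_one] at htot
  unfold goodCount
  omega

/-- For a non-degenerate one-dimensional system of size `‖Φ‖_M ≤ L`, no leading coefficient vanishes
modulo a prime `p > L` (`0 < |a_k| ≤ L < p`). [cite: GreenTao2010, Def. 1.1 and (1.1)] -/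
theorem coeff_ne_zero_mod_of_affLinSize_le {s : ℕ} {Φ : Fin s → AffLinForm 1}
    (hΦ : IsNondegenerateSystem Φ) {L : ℕ} {M : ℝ} (hL : affLinSize Φ M ≤ L) {p : ℕ}
    [Fact p.Prime] (hp : L < p) (k : Fin s) : (((Φ k).coeff 0 : ℤ) : ZMod p) ≠ 0 := by
  have ha : (Φ k).coeff 0 ≠ 0 := fun h =>
    hΦ.1 k (funext fun j => by rw [Subsingleton.elim j 0]; exact h)
  have hle : ((Φ k).coeff 0).natAbs ≤ L := natAbs_coeff_le_of_affLinSize_le hL k 0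
  exact intCast_zmod_ne_zero_of_natAbs_lt ha (lt_of_le_of_lt hle hp)

end Literature.NumberTheory.Sieve

end
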